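import Literature.NumberTheory.Sieve.HeathBrownCubicChainSums
import Literature.NumberTheory.Sieve.SieveFrameworkFundamentalLemma
import Literature.NumberTheory.Sieve.SieveFrameworkProofs
import HarnessLib

/-!
# Heath-Brown's Lemma 3.5, I: the Fundamental-Lemma set-up for `𝒜` ((6.1)–(6.2), pp. 33–35)

First file of the proof of the named fact `HeathBrown2001_lemma_3_5`
(`HeathBrownCubicSieveDecomposition`), the Fundamental-Lemma terms
`∑_{0≤n≤n₀} |T^(n)(𝒜) − κT^(n)(ℬ)| ≪ τη²X²/log X` of D. R. Heath-Brown, *Primes represented by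
`x³ + 2y³`*, Acta Math. 186 (2001), Lemma 3.5 (p. 14), proved in §6 (pp. 34–39) of the paper. This
layer carries out, for the sequence `𝒜`, the reduction of p. 34: "We could obtain versions of the
classical Fundamental Lemma appropriate to the field `K`, but it seems simpler to relate our sieve
functions to ones over the rationals", i.e. the identity (6.1)
`T^(n)(𝒜) = ∑_{X^τ ≤ p_n < ⋯ < p_1 < X^{1−τ}, p_1⋯p_n < X^{1+τ}} S(𝒜_{p_1⋯p_n}, X^τ)` via (6.2), and sets
up the rational sequences `𝒜_q` as sifted sequences for the tree's Fundamental Lemma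
(`Literature.NumberTheory.Sieve.SieveSequence.fundamental_lemma_uniform_holds`, proved in
`SieveFrameworkFundamentalLemma.lean`), with their remainders expressed through the Type I
quantities `#𝒜^(K)_R − (6η²X²/π²)ρ₂(R)/N(R)` of Lemma 3.2 (p. 33, p. 35). Everything is PROVED; no
named fact is introduced.

## Content (namespace `Literature.NumberTheory.Sieve.CubicSieve`)

* `NormSimple I` — every nonzero prime ideal factor of `I` has prime norm and distinct factors have
  distinct norms; `normSimple_pairIdeal` (**Lemma 3.1** for the members `(x + y·2^{1/3})` of `𝒜^(K)`),
  `normSimple_of_squarefree_absNorm` (ideals `R ∈ 𝒯r`, i.e. `N(R)` square-free, p. 33); for such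
  ideals the norm is a bijection from the prime ideal factors onto the prime factors of the norm
  (`NormSimple.image_absNorm_primeFactorsFinset`, `.absNorm_injOn`,
  `.exists_prime_dvd_of_dvd_absNorm`), `z`-roughness of `I` is `(N(I), P(z)) = 1`
  (`NormSimple.isRough_iff_coprime`, (6.2)), a divisor with square-free norm is determined by its norm
  (`NormSimple.eq_prod_filter_of_dvd`, p. 33), and the chains of (3.1) dividing `I` correspond to the
  rational chains dividing `N(I)` (`NormSimple.card_chains_dvd_eq`).
* `ratSmallPrimes`, `ratChains` (the ranges `X^τ ≤ p < X^{1−τ}` and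
  `{p_1, …, p_n}, p_1⋯p_n < X^{1+τ}` of (6.1)); `rho₀` (`ρ₀(p) = ν_p(1 + p^{-1})^{-1}`, Lemma 2.1),
  `densA` (the density `ρ₀(d)/d`, multiplicative), `sizeA` (`X_𝒜 = 6η²X²/π²`), `seqA X η q` (the
  multiset `𝒜_q = {x³ + 2y³ : (x, y) in the box, coprime, q ∣ x³ + 2y³}` as a
  `Literature.NumberTheory.Sieve.SieveSequence` with size `X_𝒜ρ₀(q)/q` and density `ρ₀(d)/d`, p. 34),
  `topA` (a bound for its members).
* **`Tpiece_boxPairs_eq` — (6.1) PROVED**: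
  `T^(n)(𝒜) = ∑_{t ∈ ratChains n} S(𝒜_{∏t}, X^τ)` exactly (all `n ≥ 0`, `X ≥ 0`), where
  `S(𝒜_q, z) = (seqA X η q).sifted (topA X η) (primesProdBelow z)` (`sifted_seqA_eq`).
* `normEq r` (ideals of norm `r`, `card_normEq`: `c_K(r)` of them), `rho₂_eq_of_squarefree`,
  `sum_normEq_rho₂_div_eq_densA` (**`∑_{N(R)=r} ρ₂(R)/N(R) = ρ₀(r)/r`**, p. 33),
  `card_boxPairs_dvd_eq_sum_countA` (**`#𝒜_r = ∑_{N(R)=r} #𝒜^(K)_R`** for square-free `r`, p. 33),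
  and `abs_remainder_seqA_le`: **`|R_d(𝒜_q)| ≤ ∑_{N(R)=qd} |#𝒜^(K)_R − X_𝒜ρ₂(R)/N(R)|`** (`qd`
  square-free) — the remainders of the Fundamental Lemma are Type I errors of Lemma 3.2 (p. 35).
* `hasSieveDimension_of_le_div` (a density `≤ A/p` and `≤ 1 − δ` satisfies `Ω(A)` with the explicit
  constant `exp(A(9/2 + 6/log 2) + A²/δ)`), `hasSieveDimension_densA` (`ρ₀(d)/d` satisfies `Ω(3)`
  with constant `dimConst`; `ν_p ≤ 3`, `ν_2 = ν_3 = 1`).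

## Faithfulness / modelling notes

* `𝒜_q` is a multiset over `ℤ` (weights = number of representations of `k = x³ + 2y³` by coprime
  pairs of the box), exactly as `π(𝒜)` counts representations; its level parameter `x` in
  `SieveSequence.sifted`/`congrSum` is the harmless bound `topA = 3(X(1+η))³ ≥ x³ + 2y³`.
* (6.1) is printed for the chains `p_n < ⋯ < p_1`; our `Tpiece` (previous layer) ranges over
  `n`-subsets of prime ideals, and by Lemma 3.1 a subset dividing a member of `𝒜^(K)` consists of
  first-degree primes of distinct norms, so no tie-break is involved and the identity is exact.
* The density has true dimension `1` (prime ideal theorem for the degree-one primes); we record the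
  crude `Ω(3)`, which suffices for the Fundamental Lemma (only the constant depends on it).

## References

* D. R. Heath-Brown, *Primes represented by `x³ + 2y³`*, Acta Math. 186 (2001), 1–84: Lemma 3.1
  (p. 11), Lemma 2.1 (p. 5), §5 pp. 32–33 (`#𝒜_q = ∑ #𝒜^(K)_R`, `∑ ρ₂ = ρ₀`), §6 (6.1)–(6.2) p. 34,
  p. 35 (the remainders via Lemma 2.1). [cite: HeathBrownActa2001, §6 (6.1)–(6.2)]
* H. Halberstam, H.-E. Richert, *Sieve Methods* (1974), Thm 7.1 (the Fundamental Lemma used on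
  p. 34); here replaced by the tree's `SieveSequence.fundamental_lemma_uniform`
  (Friedlander–Iwaniec, *Opera de Cribro*, Lemma 6.8 / Cor. 6.10). [cite: HalberstamRichert1974, Thm. 7.1]

## Mathlib / tree search

Mathlib: `ArithmeticFunction.prodPrimeFactors` (+ `IsMultiplicative.prodPrimeFactors`),
`Finset.prod_primes_dvd`, `Finset.prod_dvd_of_coprime`, `Ideal.IsMaximal.coprime_of_ne`,
`Prime.exists_mem_multiset_map_dvd`, `Ideal.prod_normalizedFactors_eq_self`,
`Squarefree.eq_zero_or_one_of_pow_of_not_isUnit`, `Finset.card_nbij'`,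
`Finset.card_eq_sum_card_fiberwise`, `Nat.prod_primeFactors_of_squarefree`. Tree:
`HeathBrownCubicSieveSetup` (`boxPairs`, `pairIdeal`, `absNorm_pairIdeal`, `IsRough`, `countA`,
`rho₂`, `idealsLE`, `primeFactorsFinset`), `HeathBrownCubicSieveDecomposition` (`Tpiece`, `chains`,
`smallPrimes`, `famSifted`), `HeathBrownCubicUpperBoundTools` (`mem_chains_iff`, `mem_smallPrimes_iff`),
`HeathBrownCubicChainSums` (`idealNormCount_prod_primes`), `LFunctions.CubeRootTwoField` (Lemma 3.1:
`prime_absNorm_of_mem`, `eq_of_mem_of_absNorm_eq`), `HeathBrownCubicPrimesOutlineProofs`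
(`exists_absNorm_eq_prime_pow`), `SieveFramework`/`LevelOfDistribution` (`SieveSequence`,
`primesProdBelow`, `coprime_primesProdBelow_iff`, `HasSieveDimension`), `SieveFrameworkProofs`
(`sum_primesWindow_one_div_le`), `MertensElementary` (`sum_inv_prime_mul_pred_le_one`).
-/

noncomputable section

open Polynomial NumberField Finset Filter Topology
open scoped ArithmeticFunction.omega

namespace Literature.NumberTheory.Sieve.CubicSieve

open LFunctions.CubeRootTwoField CubicPrimes
open Literature.NumberTheory.LFunctions (idealNormCount)

/-! ### Ideals whose prime factors are told apart by their norms -/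

/-- A divisor of a nonzero ideal is nonzero. [folklore] -/
theorem ne_bot_of_dvd_ne_bot {P I : Ideal (𝓞 K)} (hI : I ≠ ⊥) (h : P ∣ I) : P ≠ ⊥ := by
  rintro rfl
  obtain ⟨J, hJ⟩ := h
  exact hI (by rw [hJ, Ideal.bot_mul])

/-- `NormSimple I`: every nonzero prime ideal factor of `I` has prime norm, and distinct prime ideal
factors have distinct norms. By Lemma 3.1 the members of `𝒜^(K)` have this property
(`normSimple_pairIdeal`), and so does every ideal with square-free norm
(`normSimple_of_squarefree_absNorm`); for such ideals the prime ideal factors correspond, through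
the norm, to the prime factors of the norm, which is what drives the passage (6.1)–(6.2) from sieve
functions over `K` to sieve functions over `ℚ` (p. 34). [cite: HeathBrownActa2001, §6 (6.2)] -/
def NormSimple (I : Ideal (𝓞 K)) : Prop :=
  ∀ ⦃P : Ideal (𝓞 K)⦄, P.IsPrime → P ≠ ⊥ → P ∣ I →
    (Ideal.absNorm P).Prime ∧
      ∀ ⦃P' : Ideal (𝓞 K)⦄, P'.IsPrime → P' ∣ I → Ideal.absNorm P = Ideal.absNorm P' → P = P'

/-- `NormSimple` passes to divisors. [folklore] -/
theorem NormSimple.of_dvd {I J : Ideal (𝓞 K)} (h : NormSimple I) (hJI : J ∣ I) : NormSimple J :=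
  fun _ hP hP0 hPJ => ⟨(h hP hP0 (hPJ.trans hJI)).1,
    fun _ hP' hP'J hN => (h hP hP0 (hPJ.trans hJI)).2 hP' (hP'J.trans hJI) hN⟩

/-- **Lemma 3.1**: the members `(x + y·2^{1/3})`, `gcd(x, y) = 1`, of `𝒜^(K)` are `NormSimple`.
[cite: HeathBrownActa2001, Lemma 3.1] -/
theorem normSimple_pairIdeal {xy : ℕ × ℕ} (hcop : IsCoprime (xy.1 : ℤ) xy.2) :
    NormSimple (pairIdeal xy) := fun _ hP hP0 hPI =>
  ⟨prime_absNorm_of_mem hcop hP hP0 (intCast_mem_of_dvd_pairIdeal hPI), fun _ hP' hP'I hN =>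
    eq_of_mem_of_absNorm_eq hcop hP hP0 hP'.ne_top (intCast_mem_of_dvd_pairIdeal hPI)
      (intCast_mem_of_dvd_pairIdeal hP'I) hN⟩

/-- Coprimality of the coordinates of a member of `𝒜^(K)`, in the integer form of Lemma 3.1.
[folklore] -/
theorem isCoprime_of_mem_boxPairs {X η : ℝ} {xy : ℕ × ℕ} (hxy : xy ∈ boxPairs X η) :
    IsCoprime (xy.1 : ℤ) (xy.2 : ℤ) :=
  Nat.isCoprime_iff_coprime.mpr (mem_boxPairs_iff.mp hxy).2.2.2.2

/-- The norm of a nonzero prime ideal of `𝓞_K` is a prime power `q^f`, `f ≥ 1`. [folklore] -/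
theorem exists_absNorm_eq_prime_pow' {P : Ideal (𝓞 K)} (hP : P.IsPrime) (hP0 : P ≠ ⊥) :
    ∃ q f : ℕ, q.Prime ∧ 0 < f ∧ Ideal.absNorm P = q ^ f := by
  obtain ⟨q, f, hq, hf, hN, -⟩ := exists_absNorm_eq_prime_pow hP hP0
  exact ⟨q, f, hq, hf, hN⟩

/-- **An ideal with square-free norm is `NormSimple`**: a prime factor has norm `q^f ∣ N(R)`, so
`f = 1`; two distinct prime factors of equal norm `q` would give `q² ∣ N(R)`. (This is the converse
direction of the use of Lemma 3.1 on p. 33: the ideals `R ∈ 𝒯r`.) [cite: HeathBrownActa2001, §5 p. 33] -/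
theorem normSimple_of_squarefree_absNorm {R : Ideal (𝓞 K)} (hR : Squarefree (Ideal.absNorm R)) :
    NormSimple R := by
  intro P hP hP0 hPR
  have hNdvd : Ideal.absNorm P ∣ Ideal.absNorm R :=
    Ideal.absNorm_dvd_absNorm_of_le (Ideal.dvd_iff_le.mp hPR)
  obtain ⟨q, f, hq, hf, hNP⟩ := exists_absNorm_eq_prime_pow' hP hP0
  have hf1 : f = 1 := by
    have hsq : Squarefree (q ^ f) := by rw [← hNP]; exact hR.squarefree_of_dvd hNdvd
    rcases Squarefree.eq_zero_or_one_of_pow_of_not_isUnit hsq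
      (fun h => hq.ne_one (Nat.isUnit_iff.mp h)) with h | h
    · omega
    · exact h
  rw [hf1, pow_one] at hNP
  refine ⟨hNP ▸ hq, fun P' hP' hP'R hN => ?_⟩
  by_contra hne
  have hP'0 : P' ≠ ⊥ := by
    rintro rfl
    rw [Ideal.absNorm_bot] at hN
    exact hq.ne_zero (hNP ▸ hN)
  have hcop : IsCoprime P P' := Ideal.isCoprime_iff_sup_eq.mpr
    ((hP.isMaximal hP0).coprime_of_ne (hP'.isMaximal hP'0) hne)
  have hdvd : P * P' ∣ R := hcop.mul_dvd hPR hP'R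
  have hsq : q * q ∣ Ideal.absNorm R := by
    have := Ideal.absNorm_dvd_absNorm_of_le (Ideal.dvd_iff_le.mp hdvd)
    rwa [map_mul, ← hN, hNP] at this
  exact hq.ne_one (Nat.isUnit_iff.mp (hR q hsq))

/-- **Every prime factor of the norm of a `NormSimple` ideal is the norm of a prime ideal factor.**
For `𝒜^(K)` this is the surjectivity half of "every prime `p_i` determines a unique first degree prime
ideal `P_i` with `N(P_i) = p_i`" (p. 34). [cite: HeathBrownActa2001, §6 (6.2)] -/
theorem NormSimple.exists_prime_dvd_of_dvd_absNorm {I : Ideal (𝓞 K)} (hI : NormSimple I) (h0 : I ≠ ⊥)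
    {p : ℕ} (hp : p.Prime) (hpN : p ∣ Ideal.absNorm I) :
    ∃ P : Ideal (𝓞 K), P.IsPrime ∧ P ≠ ⊥ ∧ P ∣ I ∧ Ideal.absNorm P = p := by
  classical
  set F := UniqueFactorizationMonoid.normalizedFactors I with hF
  have hprod : Ideal.absNorm I = (F.map Ideal.absNorm).prod := by
    conv_lhs => rw [← Ideal.prod_normalizedFactors_eq_self h0]
    rw [← hF, map_multiset_prod]
  rw [hprod] at hpN
  obtain ⟨P, hPF, hpP⟩ := (Nat.prime_iff.mp hp).exists_mem_multiset_map_dvd hpN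
  have hP := (Ideal.mem_normalizedFactors_iff h0).mp hPF
  have hP0 : P ≠ ⊥ := by
    rintro rfl
    exact UniqueFactorizationMonoid.zero_notMem_normalizedFactors I
      (by rw [Ideal.zero_eq_bot]; exact hPF)
  have hPdvd : P ∣ I := Ideal.dvd_iff_le.mpr hP.2
  have hNP : (Ideal.absNorm P).Prime := (hI hP.1 hP0 hPdvd).1
  exact ⟨P, hP.1, hP0, hPdvd, ((Nat.prime_dvd_prime_iff_eq hp hNP).mp hpP).symm⟩

/-- A prime ideal factor of a `NormSimple` ideal has prime norm dividing the norm. [folklore] -/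
theorem NormSimple.prime_absNorm_and_dvd {I : Ideal (𝓞 K)} (hI : NormSimple I) (h0 : I ≠ ⊥)
    {P : Ideal (𝓞 K)} (hP : P.IsPrime) (hPI : P ∣ I) :
    (Ideal.absNorm P).Prime ∧ Ideal.absNorm P ∣ Ideal.absNorm I :=
  ⟨(hI hP (ne_bot_of_dvd_ne_bot h0 hPI) hPI).1,
    Ideal.absNorm_dvd_absNorm_of_le (Ideal.dvd_iff_le.mp hPI)⟩

/-- **A `NormSimple` ideal is `z`-rough iff its norm has no prime factor `< z`**; for `𝒜^(K)` this is
the step "`S(𝒜_{p_1⋯p_n}, z) = ∑_{N(P_i) = p_i} S_K(𝒜^(K)_{P_1⋯P_n}, z)`" of (6.2).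
[cite: HeathBrownActa2001, §6 (6.2)] -/
theorem NormSimple.isRough_iff_coprime {I : Ideal (𝓞 K)} (hI : NormSimple I) (h0 : I ≠ ⊥) (z : ℝ) :
    IsRough z I ↔ (Ideal.absNorm I).Coprime (primesProdBelow z) := by
  rw [coprime_primesProdBelow_iff]
  constructor
  · intro h q hq hqN
    rw [Nat.mem_primesBelow] at hq
    obtain ⟨P, hP, -, hPI, hNP⟩ := hI.exists_prime_dvd_of_dvd_absNorm h0 hq.2 hqN
    have hz : z ≤ (Ideal.absNorm P : ℝ) := h hP hPI
    rw [hNP] at hz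
    exact absurd (Nat.lt_ceil.mp hq.1) (not_lt.mpr hz)
  · intro h P hP hPI
    obtain ⟨hNp, hNdvd⟩ := hI.prime_absNorm_and_dvd h0 hP hPI
    by_contra hlt
    rw [not_le] at hlt
    exact h _ (Nat.mem_primesBelow.mpr ⟨Nat.lt_ceil.mpr hlt, hNp⟩) hNdvd

/-- The norm is injective on the prime ideal factors of a `NormSimple` ideal. [folklore] -/
theorem NormSimple.absNorm_injOn {I : Ideal (𝓞 K)} (hI : NormSimple I) (h0 : I ≠ ⊥) :
    Set.InjOn (fun P : Ideal (𝓞 K) => Ideal.absNorm P) (primeFactorsFinset I) := by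
  intro P₁ hP₁ P₂ hP₂ hN
  rw [mem_coe, mem_primeFactorsFinset_iff h0] at hP₁ hP₂
  exact (hI hP₁.1 (ne_bot_of_dvd_ne_bot h0 hP₁.2) hP₁.2).2 hP₂.1 hP₂.2 hN

/-- **The prime ideal factors of a `NormSimple` ideal correspond, by the norm, to the prime factors of
its norm** (p. 34, for `𝒜^(K)`: "every prime `p_i` determines a unique first degree prime ideal `P_i`
with `N(P_i) = p_i`. Conversely, if `P ∣ x + y·2^{1/3}`, then `P` will be a first degree prime
ideal"). [cite: HeathBrownActa2001, §6 (6.2)] -/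
theorem NormSimple.image_absNorm_primeFactorsFinset {I : Ideal (𝓞 K)} (hI : NormSimple I) (h0 : I ≠ ⊥) :
    (primeFactorsFinset I).image (fun P => Ideal.absNorm P) = (Ideal.absNorm I).primeFactors := by
  classical
  have hN0 : Ideal.absNorm I ≠ 0 := fun h => h0 (Ideal.absNorm_eq_zero_iff.mp h)
  ext p
  simp only [mem_image, mem_primeFactorsFinset_iff h0, Nat.mem_primeFactors]
  constructor
  · rintro ⟨P, ⟨hP, hPI⟩, rfl⟩
    obtain ⟨h1, h2⟩ := hI.prime_absNorm_and_dvd h0 hP hPI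
    exact ⟨h1, h2, hN0⟩
  · rintro ⟨hp, hpN, -⟩
    obtain ⟨P, hP, -, hPI, hNP⟩ := hI.exists_prime_dvd_of_dvd_absNorm h0 hp hpN
    exact ⟨P, ⟨hP, hPI⟩, hNP⟩

/-- A set of pairwise distinct nonzero prime ideals each dividing `I` has product dividing `I`
(distinct maximal ideals are coprime). [folklore] -/
theorem prod_dvd_of_forall_prime_dvd {s : Finset (Ideal (𝓞 K))} {I : Ideal (𝓞 K)}
    (hs : ∀ P ∈ s, P.IsPrime ∧ P ≠ ⊥ ∧ P ∣ I) : ∏ P ∈ s, P ∣ I := by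
  refine Finset.prod_dvd_of_coprime (fun P₁ hP₁ P₂ hP₂ hne => ?_) fun P hP => (hs P hP).2.2
  rw [mem_coe] at hP₁ hP₂
  have h1 := (hs P₁ hP₁).1.isMaximal (hs P₁ hP₁).2.1
  have h2 := (hs P₂ hP₂).1.isMaximal (hs P₂ hP₂).2.1
  exact Ideal.isCoprime_iff_sup_eq.mpr (h1.coprime_of_ne h2 hne)

/-- For a set `s` of nonzero prime ideals: `∏ s ∣ I` iff every member divides `I`. [folklore] -/
theorem prod_dvd_iff_forall_dvd {s : Finset (Ideal (𝓞 K))} {I : Ideal (𝓞 K)}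
    (hs : ∀ P ∈ s, P.IsPrime ∧ P ≠ ⊥) : ∏ P ∈ s, P ∣ I ↔ ∀ P ∈ s, P ∣ I :=
  ⟨fun h _ hP => (Finset.dvd_prod_of_mem (fun P : Ideal (𝓞 K) => P) hP).trans h,
    fun h => prod_dvd_of_forall_prime_dvd fun P hP => ⟨(hs P hP).1, (hs P hP).2, h P hP⟩⟩

/-- For a set `t` of primes: `∏ t ∣ n` iff every member divides `n`. [folklore] -/
theorem prod_primes_dvd_iff {t : Finset ℕ} {n : ℕ} (ht : ∀ p ∈ t, p.Prime) :
    ∏ p ∈ t, p ∣ n ↔ ∀ p ∈ t, p ∣ n :=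
  ⟨fun h _ hp => (Finset.dvd_prod_of_mem (fun p : ℕ => p) hp).trans h,
    fun h => Finset.prod_primes_dvd n (fun p hp => Nat.prime_iff.mp (ht p hp)) h⟩

/-- The product of a set of prime ideal factors of a `NormSimple` ideal has norm the product of the
corresponding rational primes. [folklore] -/
theorem NormSimple.absNorm_prod_eq {I : Ideal (𝓞 K)} (hI : NormSimple I) (h0 : I ≠ ⊥)
    {s : Finset (Ideal (𝓞 K))} (hs : s ⊆ primeFactorsFinset I) :
    Ideal.absNorm (∏ P ∈ s, P) = ∏ p ∈ s.image (fun P => Ideal.absNorm P), p := by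
  classical
  rw [map_prod, prod_image ((hI.absNorm_injOn h0).mono (coe_subset.mpr hs))]

open scoped Classical in
/-- **A divisor with square-free norm of a `NormSimple` ideal is the product of the prime ideal
factors whose norms divide its norm.** In particular (p. 33) an ideal `R ∈ 𝒯r` dividing a member of
`𝒜^(K)` is determined by `N(R)`: "if `q` is square-free … we must have `q = N(R)`".
[cite: HeathBrownActa2001, §5 p. 33] -/
theorem NormSimple.eq_prod_filter_of_dvd {I : Ideal (𝓞 K)} (hI : NormSimple I) (h0 : I ≠ ⊥)
    {R : Ideal (𝓞 K)} (hRI : R ∣ I) (hR : Squarefree (Ideal.absNorm R)) :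
    R = ∏ P ∈ (primeFactorsFinset I).filter (fun P => Ideal.absNorm P ∣ Ideal.absNorm R), P := by
  have hR0 : R ≠ ⊥ := ne_bot_of_dvd_ne_bot h0 hRI
  set F := UniqueFactorizationMonoid.normalizedFactors R with hF
  have hmemF : ∀ Q ∈ F, Q.IsPrime ∧ Q ≠ ⊥ ∧ Q ∣ R := by
    intro Q hQ
    have h := (Ideal.mem_normalizedFactors_iff hR0).mp hQ
    refine ⟨h.1, ?_, Ideal.dvd_iff_le.mpr h.2⟩
    rintro rfl
    exact UniqueFactorizationMonoid.zero_notMem_normalizedFactors R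
      (by rw [Ideal.zero_eq_bot]; exact hQ)
  have hprodF : F.prod = R := Ideal.prod_normalizedFactors_eq_self hR0
  have hNprod : Ideal.absNorm R = (F.map Ideal.absNorm).prod := by
    conv_lhs => rw [← hprodF]
    rw [map_multiset_prod]
  have hRsimple : NormSimple R := hI.of_dvd hRI
  -- the norms of the factors are primes, without repetition
  have hprime : ∀ n ∈ F.map Ideal.absNorm, n.Prime := by
    intro n hn
    obtain ⟨Q, hQ, rfl⟩ := Multiset.mem_map.mp hn
    obtain ⟨hQ1, hQ2, hQ3⟩ := hmemF Q hQ
    exact (hRsimple hQ1 hQ2 hQ3).1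
  have hnodupN : (F.map Ideal.absNorm).Nodup := by
    rw [Multiset.nodup_iff_count_le_one]
    intro n
    by_contra hcnt
    have h2 : 2 ≤ (F.map Ideal.absNorm).count n := by omega
    have hdvd : n * n ∣ (F.map Ideal.absNorm).prod := by
      have := Multiset.le_count_iff_replicate_le.mp h2
      have h := Multiset.prod_dvd_prod_of_le this
      simpa [Multiset.prod_replicate, sq] using h
    rw [← hNprod] at hdvd
    have hn1 : IsUnit n := hR n hdvd
    have hnmem : n ∈ F.map Ideal.absNorm := Multiset.count_pos.mp (by omega)
    exact (hprime n hnmem).ne_one (Nat.isUnit_iff.mp hn1)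
  have hnodup : F.Nodup := Multiset.Nodup.of_map _ hnodupN
  -- `R` is the product of the SET of its prime factors
  have hRprod : R = ∏ Q ∈ F.toFinset, Q := by
    rw [Finset.prod_eq_multiset_prod, Multiset.toFinset_val, hnodup.dedup, Multiset.map_id', hprodF]
  conv_lhs => rw [hRprod]
  congr 1
  ext P
  simp only [Multiset.mem_toFinset, mem_filter, mem_primeFactorsFinset_iff h0]
  constructor
  · intro hP
    obtain ⟨hP1, -, hP3⟩ := hmemF P hP
    exact ⟨⟨hP1, hP3.trans hRI⟩, Ideal.absNorm_dvd_absNorm_of_le (Ideal.dvd_iff_le.mp hP3)⟩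
  · rintro ⟨⟨hP1, hP2⟩, hP3⟩
    rw [hNprod] at hP3
    have hPp : (Ideal.absNorm P).Prime := (hI hP1 (ne_bot_of_dvd_ne_bot h0 hP2) hP2).1
    obtain ⟨Q, hQ, hPQ⟩ := (Nat.prime_iff.mp hPp).exists_mem_multiset_map_dvd hP3
    obtain ⟨hQ1, hQ2, hQ3⟩ := hmemF Q hQ
    have hNQ : (Ideal.absNorm Q).Prime := (hRsimple hQ1 hQ2 hQ3).1
    have heq : Ideal.absNorm P = Ideal.absNorm Q := (Nat.prime_dvd_prime_iff_eq hPp hNQ).mp hPQ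
    rwa [(hI hP1 (ne_bot_of_dvd_ne_bot h0 hP2) hP2).2 hQ1 (hQ3.trans hRI) heq]

/-! ### The rational chains and the identity (6.1) -/

/-- The rational primes `p` with `X^τ ≤ p < X^{1−τ}` (the norms of the members of `𝒫₀`,
`smallPrimes`). [cite: HeathBrownActa2001, §6 (6.1)] -/
def ratSmallPrimes (X τ : ℝ) : Finset ℕ :=
  (Nat.primesBelow ⌈X ^ (1 - τ)⌉₊).filter fun p => X ^ τ ≤ (p : ℝ)

/-- Membership in `ratSmallPrimes`. [cite: HeathBrownActa2001, §6 (6.1)] -/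
theorem mem_ratSmallPrimes_iff {X τ : ℝ} {p : ℕ} :
    p ∈ ratSmallPrimes X τ ↔ p.Prime ∧ X ^ τ ≤ (p : ℝ) ∧ (p : ℝ) < X ^ (1 - τ) := by
  rw [ratSmallPrimes, mem_filter, Nat.mem_primesBelow, Nat.lt_ceil]
  tauto

/-- **The rational chains of (6.1)**: the sets `{p_1, …, p_n}` of `n` distinct primes with
`X^τ ≤ p_i < X^{1−τ}` and `p_1⋯p_n < X^{1+τ}` (the range of summation
`X^τ ≤ p_n < ⋯ < p_1 < X^{1−τ}, p_1⋯p_n < X^{1+τ}` of (6.1)). [cite: HeathBrownActa2001, §6 (6.1)] -/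
def ratChains (X τ : ℝ) (n : ℕ) : Finset (Finset ℕ) :=
  ((ratSmallPrimes X τ).powersetCard n).filter fun t => ((∏ p ∈ t, p : ℕ) : ℝ) < X ^ (1 + τ)

/-- Membership in `ratChains`. [cite: HeathBrownActa2001, §6 (6.1)] -/
theorem mem_ratChains_iff {X τ : ℝ} {n : ℕ} {t : Finset ℕ} :
    t ∈ ratChains X τ n ↔ t ⊆ ratSmallPrimes X τ ∧ #t = n ∧ ((∏ p ∈ t, p : ℕ) : ℝ) < X ^ (1 + τ) := by
  rw [ratChains, mem_filter, mem_powersetCard, and_assoc]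

open scoped Classical in
/-- **Chains of prime ideals dividing a `NormSimple` ideal ↔ rational chains dividing its norm**:
taking norms is a bijection from the chains `{P_1, …, P_n}` of (3.1) with `P_1⋯P_n ∣ I` onto the
rational chains `{p_1, …, p_n}` of (6.1) with `p_1⋯p_n ∣ N(I)` — for `I = (x + y·2^{1/3})` this is
the counting content of (6.1)–(6.2). [cite: HeathBrownActa2001, §6 (6.1)–(6.2)] -/
theorem NormSimple.card_chains_dvd_eq {I : Ideal (𝓞 K)} (hI : NormSimple I) (h0 : I ≠ ⊥)
    (X τ : ℝ) (n : ℕ) :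
    #{s ∈ chains X τ n | ∏ P ∈ s, P ∣ I} = #{t ∈ ratChains X τ n | ∏ p ∈ t, p ∣ Ideal.absNorm I} := by
  set N := Ideal.absNorm I with hN
  have hN0 : N ≠ 0 := fun h => h0 (Ideal.absNorm_eq_zero_iff.mp h)
  have hinj := hI.absNorm_injOn h0
  -- forward map: norms; backward map: the prime ideal factors with norm in `t`
  refine card_nbij' (fun s => s.image fun P => Ideal.absNorm P)
    (fun t => (primeFactorsFinset I).filter fun P => Ideal.absNorm P ∈ t) ?_ ?_ ?_ ?_
  · -- maps into
    intro s hs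
    rw [mem_coe, mem_filter, mem_chains_iff] at hs
    obtain ⟨⟨hsub, hcard, hlt⟩, hdvd⟩ := hs
    have hsP : ∀ P ∈ s, P.IsPrime ∧ P ≠ ⊥ := fun P hP =>
      ⟨(mem_smallPrimes_iff.mp (hsub hP)).1, (mem_smallPrimes_iff.mp (hsub hP)).2.1⟩
    have hdvd' := (prod_dvd_iff_forall_dvd hsP).mp hdvd
    have hsF : s ⊆ primeFactorsFinset I := fun P hP =>
      (mem_primeFactorsFinset_iff h0).mpr ⟨(hsP P hP).1, hdvd' P hP⟩
    have hinj_s : Set.InjOn (fun P : Ideal (𝓞 K) => Ideal.absNorm P) s := hinj.mono (coe_subset.mpr hsF)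
    have hprod : ∏ p ∈ s.image (fun P => Ideal.absNorm P), p = Ideal.absNorm (∏ P ∈ s, P) :=
      (hI.absNorm_prod_eq h0 hsF).symm
    rw [mem_coe, mem_filter, mem_ratChains_iff]
    refine ⟨⟨fun p hp => ?_, by rw [card_image_of_injOn hinj_s, hcard], by rw [hprod]; exact hlt⟩, ?_⟩
    · obtain ⟨P, hP, rfl⟩ := mem_image.mp hp
      obtain ⟨hPp, -, h1, h2⟩ := mem_smallPrimes_iff.mp (hsub hP)
      exact mem_ratSmallPrimes_iff.mpr ⟨(hI.prime_absNorm_and_dvd h0 hPp (hdvd' P hP)).1, h1, h2⟩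
    · rw [hprod]
      exact Ideal.absNorm_dvd_absNorm_of_le (Ideal.dvd_iff_le.mp hdvd)
  · -- maps back
    intro t ht
    rw [mem_coe, mem_filter, mem_ratChains_iff] at ht
    obtain ⟨⟨hsub, hcard, hlt⟩, hdvd⟩ := ht
    have htp : ∀ p ∈ t, p.Prime := fun p hp => (mem_ratSmallPrimes_iff.mp (hsub hp)).1
    have hdvd' := (prod_primes_dvd_iff htp).mp hdvd
    set s := (primeFactorsFinset I).filter fun P => Ideal.absNorm P ∈ t with hs
    have hsF : s ⊆ primeFactorsFinset I := filter_subset _ _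
    have hinj_s : Set.InjOn (fun P : Ideal (𝓞 K) => Ideal.absNorm P) s := hinj.mono (coe_subset.mpr hsF)
    have himage : s.image (fun P => Ideal.absNorm P) = t := by
      ext p
      simp only [mem_image, hs, mem_filter, mem_primeFactorsFinset_iff h0]
      constructor
      · rintro ⟨P, ⟨-, hPt⟩, rfl⟩; exact hPt
      · intro hp
        obtain ⟨P, hP, -, hPI, hNP⟩ := hI.exists_prime_dvd_of_dvd_absNorm h0 (htp p hp) (hdvd' p hp)
        exact ⟨P, ⟨⟨hP, hPI⟩, by rw [hNP]; exact hp⟩, hNP⟩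
    have hsP : ∀ P ∈ s, P.IsPrime ∧ P ≠ ⊥ ∧ P ∣ I := by
      intro P hP
      obtain ⟨hPF, -⟩ := mem_filter.mp hP
      obtain ⟨hPp, hPI⟩ := (mem_primeFactorsFinset_iff h0).mp hPF
      exact ⟨hPp, ne_bot_of_mem_primeFactorsFinset h0 hPF, hPI⟩
    have hprod : Ideal.absNorm (∏ P ∈ s, P) = ∏ p ∈ t, p := by
      rw [hI.absNorm_prod_eq h0 hsF, himage]
    rw [mem_coe, mem_filter, mem_chains_iff]
    refine ⟨⟨fun P hP => ?_, ?_, by rw [hprod]; exact hlt⟩, prod_dvd_of_forall_prime_dvd hsP⟩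
    · obtain ⟨hPp, hP0, -⟩ := hsP P hP
      have hNt : Ideal.absNorm P ∈ t := (mem_filter.mp hP).2
      obtain ⟨-, h1, h2⟩ := mem_ratSmallPrimes_iff.mp (hsub hNt)
      exact mem_smallPrimes_iff.mpr ⟨hPp, hP0, h1, h2⟩
    · rw [← card_image_of_injOn hinj_s, himage, hcard]
  · -- left inverse
    intro s hs
    rw [mem_coe, mem_filter, mem_chains_iff] at hs
    obtain ⟨⟨hsub, -, -⟩, hdvd⟩ := hs
    have hsP : ∀ P ∈ s, P.IsPrime ∧ P ≠ ⊥ := fun P hP =>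
      ⟨(mem_smallPrimes_iff.mp (hsub hP)).1, (mem_smallPrimes_iff.mp (hsub hP)).2.1⟩
    have hdvd' := (prod_dvd_iff_forall_dvd hsP).mp hdvd
    have hsF : s ⊆ primeFactorsFinset I := fun P hP =>
      (mem_primeFactorsFinset_iff h0).mpr ⟨(hsP P hP).1, hdvd' P hP⟩
    ext P
    simp only [mem_filter, mem_image]
    constructor
    · rintro ⟨hPF, Q, hQ, hQP⟩
      rwa [← hinj (hsF hQ) hPF hQP]
    · intro hP
      exact ⟨hsF hP, P, hP, rfl⟩
  · -- right inverse
    intro t ht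
    rw [mem_coe, mem_filter, mem_ratChains_iff] at ht
    obtain ⟨⟨hsub, -, -⟩, hdvd⟩ := ht
    have htp : ∀ p ∈ t, p.Prime := fun p hp => (mem_ratSmallPrimes_iff.mp (hsub hp)).1
    have hdvd' := (prod_primes_dvd_iff htp).mp hdvd
    ext p
    simp only [mem_image, mem_filter, mem_primeFactorsFinset_iff h0]
    constructor
    · rintro ⟨P, ⟨-, hPt⟩, rfl⟩; exact hPt
    · intro hp
      obtain ⟨P, hP, -, hPI, hNP⟩ := hI.exists_prime_dvd_of_dvd_absNorm h0 (htp p hp) (hdvd' p hp)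
      exact ⟨P, ⟨⟨hP, hPI⟩, by rw [hNP]; exact hp⟩, hNP⟩

/-! ### Heath-Brown's `ρ₀`, the density `ρ₀(d)/d`, and the rational sequences `𝒜_q` -/

/-- Heath-Brown's `ρ₀(p) = ν_p (1 + p^{-1})^{-1}` ("Lemma 2.1. For any `q ∈ ℕ` let `ρ₀(q)` be the
multiplicative function defined by `ρ₀(p^e) = ν_p/(1 + p^{-1})`, where `ν_p` is the number of first
degree prime ideals above `p`"), the local density of `𝒜 = {x³ + 2y³ : gcd(x, y) = 1}`:
`#𝒜_q ≈ (6η²X²/π²) ρ₀(q)/q`. [cite: HeathBrownActa2001, Lemma 2.1] -/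
def rho₀ (p : ℕ) : ℝ := (cubeRootTwoCount p : ℝ) / (1 + (p : ℝ)⁻¹)

/-- `ρ₀(p) = ν_p p/(p + 1)` for `p ≥ 1`. [cite: HeathBrownActa2001, Lemma 2.1] -/
theorem rho₀_eq {p : ℕ} (hp : 0 < p) : rho₀ p = cubeRootTwoCount p * p / (p + 1) := by
  have hp' : (0 : ℝ) < p := by exact_mod_cast hp
  rw [rho₀]
  field_simp

/-- `ρ₀(p) ≥ 0`. [folklore] -/
theorem rho₀_nonneg (p : ℕ) : 0 ≤ rho₀ p := by
  rw [rho₀]; positivity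

/-- `ρ₀(p)/p = ν_p/(p + 1)` for `p ≥ 1`. [cite: HeathBrownActa2001, Lemma 2.1] -/
theorem rho₀_div_eq {p : ℕ} (hp : 0 < p) : rho₀ p / p = cubeRootTwoCount p / (p + 1) := by
  have hp' : (0 : ℝ) < p := by exact_mod_cast hp
  rw [rho₀_eq hp]
  field_simp

/-- `ρ₀(p)/p ≤ 3/(p + 1)` for a prime `p` (`ν_p ≤ 3`). [folklore] -/
theorem rho₀_div_le {p : ℕ} (hp : p.Prime) : rho₀ p / p ≤ 3 / (p + 1) := by
  rw [rho₀_div_eq hp.pos]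
  have : (cubeRootTwoCount p : ℝ) ≤ 3 := by exact_mod_cast cubeRootTwoCount_le_three hp
  gcongr

/-- **The density `g₀(d) = ρ₀(d)/d = ∏_{p ∣ d} ρ₀(p)/p`** of the sieve problem for `𝒜_q`
("'`ω(p)`' `= ρ₀(p)`", p. 34), as a multiplicative arithmetic function (it only matters on
square-free `d`). [cite: HeathBrownActa2001, §6 p. 34] -/
def densA : ArithmeticFunction ℝ := ArithmeticFunction.prodPrimeFactors fun p => rho₀ p / p

/-- `densA` is multiplicative. [folklore] -/
theorem isMultiplicative_densA : densA.IsMultiplicative :=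
  ArithmeticFunction.IsMultiplicative.prodPrimeFactors _

/-- `densA d = ∏_{p ∣ d} ρ₀(p)/p` for `d ≠ 0`. [cite: HeathBrownActa2001, §6 p. 34] -/
theorem densA_apply {d : ℕ} (hd : d ≠ 0) : densA d = ∏ p ∈ d.primeFactors, rho₀ p / p := by
  rw [densA, ArithmeticFunction.prodPrimeFactors_apply hd]

/-- `densA p = ρ₀(p)/p = ν_p/(p+1)` at a prime. [cite: HeathBrownActa2001, §6 p. 34] -/
theorem densA_prime {p : ℕ} (hp : p.Prime) : densA p = cubeRootTwoCount p / (p + 1) := by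
  rw [densA_apply hp.ne_zero, hp.primeFactors, prod_singleton, rho₀_div_eq hp.pos]

/-- `densA d ≥ 0`. [folklore] -/
theorem densA_nonneg (d : ℕ) : 0 ≤ densA d := by
  rcases eq_or_ne d 0 with rfl | hd
  · simp [densA]
  · rw [densA_apply hd]
    exact prod_nonneg fun p _ => div_nonneg (rho₀_nonneg p) (Nat.cast_nonneg p)

/-- On a set of distinct primes, `densA (∏ t) = ∏_{p ∈ t} ν_p/(p+1)`. [folklore] -/
theorem densA_prod_primes {t : Finset ℕ} (ht : ∀ p ∈ t, p.Prime) :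
    densA (∏ p ∈ t, p) = ∏ p ∈ t, (cubeRootTwoCount p : ℝ) / (p + 1) := by
  have h0 : ∏ p ∈ t, p ≠ 0 := prod_ne_zero_iff.mpr fun p hp => (ht p hp).ne_zero
  rw [densA_apply h0, Nat.primeFactors_prod ht]
  exact prod_congr rfl fun p hp => rho₀_div_eq (ht p hp).pos

/-- `X_𝒜 = 6η²X²/π²`, the expected number of coprime pairs in the box `(X, X(1+η)]²` ("'`X`'
`= 6η²X²/π²`", p. 34). [cite: HeathBrownActa2001, §6 p. 34] -/
def sizeA (X η : ℝ) : ℝ := 6 * η ^ 2 * X ^ 2 / Real.pi ^ 2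

/-- `X_𝒜 ≥ 0`. [folklore] -/
theorem sizeA_nonneg (X η : ℝ) : 0 ≤ sizeA X η := by
  rw [sizeA]; positivity

/-- A bound for the members of `𝒜`: `x³ + 2y³ ≤ 3 (X(1+η))³` on the box. [folklore] -/
def topA (X η : ℝ) : ℝ := 3 * (X * (1 + η)) ^ 3

/-- **The rational sequence `𝒜_q` of §6 as a sifted sequence**: the multiset
`{x³ + 2y³ : x, y ∈ (X, X(1+η)], gcd(x, y) = 1, q ∣ x³ + 2y³}` (weights = number of
representations), with expected size `X_𝒜 ρ₀(q)/q` and density `ρ₀(d)/d` ("We apply this with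
'`ω(p)`' `= ρ₀(p)`, '`X`' `= 6η²X²ρ₀(q)/(π²q)`", p. 34, the factor `ρ₀(q)/q` being that of `M(q)`).
[cite: HeathBrownActa2001, §6 p. 34] -/
def seqA (X η : ℝ) (q : ℕ) : SieveSequence where
  a k := (#{xy ∈ boxPairs X η | xy.1 ^ 3 + 2 * xy.2 ^ 3 = k ∧ q ∣ k} : ℝ)
  a_nonneg _ := Nat.cast_nonneg _
  size _ := sizeA X η * densA q
  density := densA
  density_mult := isMultiplicative_densA

/-- The members of the box have `1 ≤ x³ + 2y³ ≤ 3(X(1+η))³` (`X ≥ 0`). [folklore] -/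
theorem norm_mem_Ioc_of_mem_boxPairs {X η : ℝ} (hX : 0 ≤ X) {xy : ℕ × ℕ} (hxy : xy ∈ boxPairs X η) :
    xy.1 ^ 3 + 2 * xy.2 ^ 3 ∈ Ioc 0 ⌊topA X η⌋₊ := by
  obtain ⟨hx1, hx2, hy1, hy2, -⟩ := mem_boxPairs_iff.mp hxy
  have hx0 : (0 : ℝ) ≤ xy.1 := Nat.cast_nonneg _
  have hy0 : (0 : ℝ) ≤ xy.2 := Nat.cast_nonneg _
  rw [mem_Ioc]
  refine ⟨?_, Nat.le_floor ?_⟩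
  · have : 0 < xy.1 := by exact_mod_cast hX.trans_lt hx1
    positivity
  · rw [topA]
    push_cast
    linarith [pow_le_pow_left₀ hx0 hx2 3, pow_le_pow_left₀ hy0 hy2 3]

/-- **Sums of `𝒜_q` over a set of integers count pairs**: for any condition `c`,
`∑_{k ≤ 3(X(1+η))³, c(k)} a_k(𝒜_q) = #{(x, y) : q ∣ x³ + 2y³, c(x³ + 2y³)}`. [folklore] -/
theorem sum_seqA_a_filter {X η : ℝ} (hX : 0 ≤ X) (q : ℕ) (c : ℕ → Prop) [DecidablePred c] :
    ∑ k ∈ (Ioc 0 ⌊topA X η⌋₊).filter c, (seqA X η q).a k =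
      #{xy ∈ boxPairs X η | q ∣ xy.1 ^ 3 + 2 * xy.2 ^ 3 ∧ c (xy.1 ^ 3 + 2 * xy.2 ^ 3)} := by
  classical
  have hmaps : Set.MapsTo (fun xy : ℕ × ℕ => xy.1 ^ 3 + 2 * xy.2 ^ 3)
      ({xy ∈ boxPairs X η | q ∣ xy.1 ^ 3 + 2 * xy.2 ^ 3 ∧ c (xy.1 ^ 3 + 2 * xy.2 ^ 3)} : Finset (ℕ × ℕ))
      ((Ioc 0 ⌊topA X η⌋₊).filter c) := by
    intro xy hxy
    rw [mem_coe, mem_filter] at hxy ⊢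
    exact ⟨norm_mem_Ioc_of_mem_boxPairs hX hxy.1, hxy.2.2⟩
  rw [card_eq_sum_card_fiberwise hmaps, Nat.cast_sum]
  refine sum_congr rfl fun k hk => ?_
  simp only [seqA, filter_filter]
  congr 2
  ext xy
  simp only [mem_filter, and_congr_right_iff]
  intro _
  constructor
  · rintro ⟨rfl, h2⟩; exact ⟨⟨h2, (mem_filter.mp hk).2⟩, rfl⟩
  · rintro ⟨⟨h1, -⟩, rfl⟩; exact ⟨rfl, h1⟩

/-- **`S(𝒜_q, z)` counts the pairs with `q ∣ x³ + 2y³` and `(x³ + 2y³, P(z)) = 1`.** [folklore] -/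
theorem sifted_seqA_eq {X η : ℝ} (hX : 0 ≤ X) (q : ℕ) (z : ℝ) :
    (seqA X η q).sifted (topA X η) (primesProdBelow z) =
      #{xy ∈ boxPairs X η | q ∣ xy.1 ^ 3 + 2 * xy.2 ^ 3 ∧
        (xy.1 ^ 3 + 2 * xy.2 ^ 3).Coprime (primesProdBelow z)} := by
  rw [SieveSequence.sifted, sum_seqA_a_filter hX]

/-- **`(𝒜_q)_d` counts the pairs with `q ∣ x³ + 2y³` and `d ∣ x³ + 2y³`.** [folklore] -/
theorem congrSum_seqA_eq {X η : ℝ} (hX : 0 ≤ X) (q d : ℕ) :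
    (seqA X η q).congrSum d (topA X η) =
      #{xy ∈ boxPairs X η | q ∣ xy.1 ^ 3 + 2 * xy.2 ^ 3 ∧ d ∣ xy.1 ^ 3 + 2 * xy.2 ^ 3} := by
  rw [SieveSequence.congrSum, sum_seqA_a_filter hX]

/-- Double counting: `∑_{a ∈ A} #{b ∈ B : p a b} = ∑_{b ∈ B} #{a ∈ A : p a b}`. [folklore] -/
theorem sum_card_filter_comm {α β : Type*} (A : Finset α) (B : Finset β) (p : α → β → Prop)
    [∀ a b, Decidable (p a b)] :
    ∑ a ∈ A, #{b ∈ B | p a b} = ∑ b ∈ B, #{a ∈ A | p a b} := by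
  simp only [card_filter]
  exact sum_comm

open scoped Classical in
/-- **(6.1): `T^(n)(𝒜) = ∑_{X^τ ≤ p_n < ⋯ < p_1 < X^{1−τ}, p_1⋯p_n < X^{1+τ}} S(𝒜_{p_1⋯p_n}, X^τ)`** — the
Fundamental-Lemma terms of the decomposition over `K` are sifting functions over `ℚ` ("it seems
simpler to relate our sieve functions to ones over the rationals. … We therefore proceed to show that
(6.1) … by demonstrating that `S(𝒜_{p_1⋯p_n}, z) = ∑_{N(P_i) = p_i} S_K(𝒜^(K)_{P_1⋯P_n}, z)` (6.2) if
`p_i ≥ z`", p. 34). Exact, for every `X ≥ 0`, `η`, `τ`, `n` (including `n = 0`: `T^(0) = S₁`), by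
Lemma 3.1 (`NormSimple.card_chains_dvd_eq`, `NormSimple.isRough_iff_coprime`).
[cite: HeathBrownActa2001, §6 (6.1)–(6.2)] -/
theorem Tpiece_boxPairs_eq {X : ℝ} (hX : 0 ≤ X) (η τ : ℝ) (n : ℕ) :
    (Tpiece (boxPairs X η) pairIdeal X τ n : ℝ) =
      ∑ t ∈ ratChains X τ n, (seqA X η (∏ p ∈ t, p)).sifted (topA X η) (primesProdBelow (X ^ τ)) := by
  simp only [sifted_seqA_eq hX, Tpiece, famSifted]
  rw [← Nat.cast_sum, Nat.cast_inj, sum_card_filter_comm, sum_card_filter_comm (ratChains X τ n)]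
  refine sum_congr rfl fun xy hxy => ?_
  have h0 : pairIdeal xy ≠ ⊥ := pairIdeal_ne_bot_of_mem_boxPairs hX xy hxy
  have hI : NormSimple (pairIdeal xy) := normSimple_pairIdeal (isCoprime_of_mem_boxPairs hxy)
  rw [← absNorm_pairIdeal]
  by_cases hr : IsRough (X ^ τ) (pairIdeal xy)
  · have hc := (hI.isRough_iff_coprime h0 (X ^ τ)).mp hr
    rw [filter_congr (q := fun s => ∏ P ∈ s, P ∣ pairIdeal xy) fun s _ => and_iff_left hr,
      filter_congr (q := fun t => ∏ p ∈ t, p ∣ Ideal.absNorm (pairIdeal xy)) fun t _ => and_iff_left hc]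
    exact hI.card_chains_dvd_eq h0 X τ n
  · have hc : ¬ (Ideal.absNorm (pairIdeal xy)).Coprime (primesProdBelow (X ^ τ)) :=
      fun h => hr ((hI.isRough_iff_coprime h0 (X ^ τ)).mpr h)
    rw [filter_false_of_mem fun s _ h => hr h.2, filter_false_of_mem fun t _ h => hc h.2,
      card_empty, card_empty]


/-! ### `#𝒜_r` through `#𝒜^(K)_R`, and `ρ₀(r)/r` through `ρ₂(R)/N(R)` (pp. 32–33) -/

/-- The ideals of `𝓞_K` of norm exactly `r` (the range `∑_{N(R) = q}` of p. 33). [folklore] -/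
def normEq (r : ℕ) : Finset (Ideal (𝓞 K)) := (idealsLE r).filter fun R => Ideal.absNorm R = r

/-- Membership in `normEq r`. [folklore] -/
@[simp] theorem mem_normEq {r : ℕ} {R : Ideal (𝓞 K)} : R ∈ normEq r ↔ Ideal.absNorm R = r := by
  rw [normEq, mem_filter, mem_idealsLE]
  exact ⟨fun h => h.2, fun h => ⟨h.le, h⟩⟩

/-- `#(normEq r) = c_K(r)`, the number of ideals of norm `r`. [folklore] -/
theorem card_normEq (r : ℕ) : #(normEq r) = idealNormCount K r := by
  rw [idealNormCount, ← Nat.card_eq_finsetCard]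
  exact Nat.card_congr (Equiv.subtypeEquivRight fun R => mem_normEq)

/-- For square-free `r`, `c_K(r) = ∏_{p ∣ r} ν_p` (multiplicativity of `c_K` on coprime arguments
and Dedekind's theorem `c_K(p) = ν_p`). [cite: HeathBrownActa2001, §5 p. 33] -/
theorem idealNormCount_eq_prod_of_squarefree {r : ℕ} (hr : Squarefree r) :
    idealNormCount K r = ∏ p ∈ r.primeFactors, cubeRootTwoCount p := by
  conv_lhs => rw [← Nat.prod_primeFactors_of_squarefree hr]
  rw [idealNormCount_prod_primes _ fun p hp => Nat.prime_of_mem_primeFactors hp]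
  refine prod_congr rfl fun p hp => ?_
  exact card_absNorm_eq_prime_eq_cubeRootTwoCount (Nat.prime_of_mem_primeFactors hp)

/-- **`ρ₂(R)` depends only on `N(R)` when `N(R)` is square-free**: `ρ₂(R) = ∏_{p ∣ N(R)} (1 + p^{-1})^{-1}`
(the prime factors of `R` are first-degree primes with the distinct norms `p ∣ N(R)`).
[cite: HeathBrownActa2001, §5 (5.4)] -/
theorem rho₂_eq_of_squarefree {R : Ideal (𝓞 K)} (hR : Squarefree (Ideal.absNorm R)) :
    rho₂ R = ∏ p ∈ (Ideal.absNorm R).primeFactors, (1 + (p : ℝ)⁻¹)⁻¹ := by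
  classical
  have hR0 : R ≠ ⊥ := fun h => by
    rw [h, Ideal.absNorm_bot] at hR
    exact not_squarefree_zero hR
  have hI := normSimple_of_squarefree_absNorm hR
  rw [rho₂, ← hI.image_absNorm_primeFactorsFinset hR0, prod_image (hI.absNorm_injOn hR0)]

/-- **`∑_{N(R) = r} ρ₂(R)/N(R) = ρ₀(r)/r` for square-free `r`** (p. 33: "This is multiplicative in `q`,
and for `q = p`, prime, it reduces to `ρ₀(p)/p`"): there are `∏_{p∣r} ν_p` ideals of norm `r`, each
with `ρ₂(R) = ∏_{p∣r}(1 + p^{-1})^{-1}`. [cite: HeathBrownActa2001, §5 p. 33] -/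
theorem sum_normEq_rho₂_div_eq_densA {r : ℕ} (hr : Squarefree r) :
    ∑ R ∈ normEq r, rho₂ R / Ideal.absNorm R = densA r := by
  have hval : ∀ R ∈ normEq r, rho₂ R / Ideal.absNorm R =
      (∏ p ∈ r.primeFactors, (1 + (p : ℝ)⁻¹)⁻¹) / r := by
    intro R hR
    rw [mem_normEq] at hR
    rw [rho₂_eq_of_squarefree (hR ▸ hr), hR]
  rw [sum_congr rfl hval, sum_const, card_normEq, idealNormCount_eq_prod_of_squarefree hr,
    nsmul_eq_mul]
  conv_rhs => rw [← Nat.prod_primeFactors_of_squarefree hr]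
  rw [densA_prod_primes fun p hp => Nat.prime_of_mem_primeFactors hp]
  conv_lhs => rw [← Nat.prod_primeFactors_of_squarefree hr]
  rw [Nat.primeFactors_prod fun p hp => Nat.prime_of_mem_primeFactors hp]
  push_cast
  rw [← prod_div_distrib, ← prod_mul_distrib]
  refine prod_congr rfl fun p hp => ?_
  have hp0 : (0 : ℝ) < p := by exact_mod_cast (Nat.prime_of_mem_primeFactors hp).pos
  field_simp

open scoped Classical in
/-- **`#𝒜_r = ∑_{N(R) = r} #𝒜^(K)_R` for square-free `r`** (p. 33: "`#𝒜_q = ∑_{R∣q, q∣N(R)} #𝒜^(K)_R`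
if `q` is square-free. By Lemma 3.1 we have `#𝒜^(K)_R = 0` unless `R ∈ 𝒯r`, in which case we must
have `q = N(R)`"): a pair with `r ∣ x³ + 2y³` is divisible by exactly one ideal of norm `r`, the product
of its prime ideal factors of norm dividing `r`. [cite: HeathBrownActa2001, §5 p. 33] -/
theorem card_boxPairs_dvd_eq_sum_countA {X : ℝ} (hX : 0 ≤ X) (η : ℝ) {r : ℕ} (hr : Squarefree r) :
    (#{xy ∈ boxPairs X η | r ∣ xy.1 ^ 3 + 2 * xy.2 ^ 3} : ℝ) = ∑ R ∈ normEq r, (countA X η R : ℝ) := by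
  rw [← Nat.cast_sum, Nat.cast_inj]
  simp only [countA, APairs]
  rw [sum_card_filter_comm (normEq r) (boxPairs X η) fun R xy => R ∣ pairIdeal xy, card_eq_sum_ones,
    sum_filter]
  refine sum_congr rfl fun xy hxy => ?_
  have h0 : pairIdeal xy ≠ ⊥ := pairIdeal_ne_bot_of_mem_boxPairs hX xy hxy
  have hI : NormSimple (pairIdeal xy) := normSimple_pairIdeal (isCoprime_of_mem_boxPairs hxy)
  rw [← absNorm_pairIdeal]
  split_ifs with hdvd
  · -- exactly one ideal of norm `r` divides `(x + yθ)`
    set R₀ := ∏ P ∈ (primeFactorsFinset (pairIdeal xy)).filter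
      (fun P => Ideal.absNorm P ∣ r), P with hR₀
    have hsub : (primeFactorsFinset (pairIdeal xy)).filter (fun P => Ideal.absNorm P ∣ r) ⊆
        primeFactorsFinset (pairIdeal xy) := filter_subset _ _
    have hR₀dvd : R₀ ∣ pairIdeal xy := by
      refine prod_dvd_of_forall_prime_dvd fun P hP => ?_
      have hPF := hsub hP
      obtain ⟨hPp, hPI⟩ := (mem_primeFactorsFinset_iff h0).mp hPF
      exact ⟨hPp, ne_bot_of_mem_primeFactorsFinset h0 hPF, hPI⟩
    have hR₀N : Ideal.absNorm R₀ = r := by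
      rw [hR₀, hI.absNorm_prod_eq h0 hsub]
      have himg : ((primeFactorsFinset (pairIdeal xy)).filter (fun P => Ideal.absNorm P ∣ r)).image
          (fun P => Ideal.absNorm P) = r.primeFactors := by
        ext p
        simp only [mem_image, mem_filter, mem_primeFactorsFinset_iff h0, Nat.mem_primeFactors, ne_eq]
        constructor
        · rintro ⟨P, ⟨⟨hPp, hPI⟩, hPr⟩, rfl⟩
          exact ⟨(hI.prime_absNorm_and_dvd h0 hPp hPI).1, hPr, hr.ne_zero⟩
        · rintro ⟨hp, hpr, -⟩
          obtain ⟨P, hP, -, hPI, hNP⟩ := hI.exists_prime_dvd_of_dvd_absNorm h0 hp (hpr.trans hdvd)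
          exact ⟨P, ⟨⟨hP, hPI⟩, hNP ▸ hpr⟩, hNP⟩
      rw [himg, Nat.prod_primeFactors_of_squarefree hr]
    rw [eq_comm, card_eq_one]
    refine ⟨R₀, ?_⟩
    ext R
    simp only [mem_filter, mem_normEq, mem_singleton]
    constructor
    · rintro ⟨hRN, hRI⟩
      rw [hI.eq_prod_filter_of_dvd h0 hRI (hRN ▸ hr), hRN]
    · rintro rfl
      exact ⟨hR₀N, hR₀dvd⟩
  · rw [eq_comm, card_eq_zero, filter_eq_empty_iff]
    intro R hR hRI
    rw [mem_normEq] at hR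
    exact hdvd (hR ▸ Ideal.absNorm_dvd_absNorm_of_le (Ideal.dvd_iff_le.mp hRI))

open scoped Classical in
/-- **The remainders of `𝒜_q` are bounded by the Type I errors of Lemma 3.2.** For square-free `qd`:
`|R_d(𝒜_q)| = |#𝒜_{qd} − X_𝒜 ρ₀(qd)/(qd)| ≤ ∑_{N(R) = qd} |#𝒜^(K)_R − X_𝒜 ρ₂(R)/N(R)|` ("the error
term `E(q)` contributes … by Lemma 2.1", p. 35; Lemma 2.1 being Lemma 3.2 summed over `N(R) = q`,
p. 33). [cite: HeathBrownActa2001, §6 p. 35] -/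
theorem abs_remainder_seqA_le {X : ℝ} (hX : 0 ≤ X) (η : ℝ) {q d : ℕ} (hqd : Squarefree (q * d)) :
    |(seqA X η q).remainder d (topA X η)| ≤
      ∑ R ∈ normEq (q * d), |(countA X η R : ℝ) - sizeA X η * rho₂ R / Ideal.absNorm R| := by
  have hcop : q.Coprime d := Nat.coprime_of_squarefree_mul hqd
  have hcongr : (seqA X η q).congrSum d (topA X η) =
      #{xy ∈ boxPairs X η | q * d ∣ xy.1 ^ 3 + 2 * xy.2 ^ 3} := by
    rw [congrSum_seqA_eq hX]
    congr 2
    exact filter_congr fun xy _ =>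
      ⟨fun h => hcop.mul_dvd_of_dvd_of_dvd h.1 h.2,
        fun h => ⟨dvd_of_mul_right_dvd h, dvd_of_mul_left_dvd h⟩⟩
  have hrem : (seqA X η q).remainder d (topA X η) =
      ∑ R ∈ normEq (q * d), ((countA X η R : ℝ) - sizeA X η * rho₂ R / Ideal.absNorm R) := by
    rw [SieveSequence.remainder, hcongr, card_boxPairs_dvd_eq_sum_countA hX η hqd, sum_sub_distrib]
    congr 1
    change densA d * (sizeA X η * densA q) = _
    have hs : ∑ R ∈ normEq (q * d), sizeA X η * rho₂ R / Ideal.absNorm R =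
        sizeA X η * ∑ R ∈ normEq (q * d), rho₂ R / Ideal.absNorm R := by
      rw [mul_sum]
      exact sum_congr rfl fun R _ => mul_div_assoc _ _ _
    rw [hs, sum_normEq_rho₂_div_eq_densA hqd, isMultiplicative_densA.map_mul_of_coprime hcop]
    ring
  rw [hrem]
  exact abs_sum_le_sum_abs _ _

/-! ### The density `ρ₀(d)/d` has sieve dimension (at most) `3` -/

/-- `(1 − t)^{-1} ≤ exp(t + t²/δ)` for `t ≤ 1 − δ`, `δ > 0`. [folklore] -/
theorem inv_one_sub_le_exp {t δ : ℝ} (hδ : 0 < δ) (ht : t ≤ 1 - δ) :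
    (1 - t)⁻¹ ≤ Real.exp (t + t ^ 2 / δ) := by
  have h1t : 0 < 1 - t := by linarith
  have hkey : (1 - t)⁻¹ = t / (1 - t) + 1 := by field_simp; ring
  have hfrac : t / (1 - t) ≤ t + t ^ 2 / δ := by
    have h1 : t / (1 - t) = t + t ^ 2 / (1 - t) := by field_simp; ring
    have h2 : t ^ 2 / (1 - t) ≤ t ^ 2 / δ := div_le_div_of_nonneg_left (sq_nonneg t) hδ (by linarith)
    linarith
  calc (1 - t)⁻¹ = t / (1 - t) + 1 := hkey
    _ ≤ Real.exp (t / (1 - t)) := Real.add_one_le_exp _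
    _ ≤ Real.exp (t + t ^ 2 / δ) := Real.exp_le_exp.mpr hfrac

/-- **A density dominated by `A/p` and bounded away from `1` has sieve dimension `A`.** If
`0 ≤ g(p) ≤ A/p` and `g(p) ≤ 1 − δ` at every prime, then
`∏_{w ≤ p < z} (1 − g(p))^{-1} ≤ exp(A(9/2 + 6/log 2) + A²/δ) (log z/log w)^A` for `2 ≤ w ≤ z`
(termwise `(1 − g)^{-1} ≤ exp(g + g²/δ)` and Mertens over the window,
`Literature.NumberTheory.Sieve.sum_primesWindow_one_div_le`). [folklore] -/
theorem hasSieveDimension_of_le_div {g : ArithmeticFunction ℝ} {A : ℕ} {δ : ℝ} (hδ : 0 < δ)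
    (hg : ∀ p : ℕ, p.Prime → 0 ≤ g p ∧ g p ≤ A / p ∧ g p ≤ 1 - δ) :
    HasSieveDimension g A (Real.exp (A * (9 / 2 + 6 / Real.log 2) + A ^ 2 / δ)) := by
  refine ⟨fun p hp => ⟨(hg p hp).1, by linarith [(hg p hp).2.2]⟩, fun w z hw hwz => ?_⟩
  set S := (Nat.primesBelow ⌈z⌉₊).filter (fun p : ℕ => w ≤ (p : ℝ)) with hS
  have hlogw : 0 < Real.log w := Real.log_pos (by linarith)
  have hlogz : 0 < Real.log z := Real.log_pos (by linarith)
  have hmemS : ∀ p ∈ S, p.Prime ∧ w ≤ (p : ℝ) ∧ p ≤ ⌊z⌋₊ := by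
    intro p hp
    rw [hS, Finset.mem_filter, Nat.mem_primesBelow] at hp
    exact ⟨hp.1.2, hp.2, Nat.le_floor (Nat.lt_ceil.mp hp.1.1).le⟩
  have hSle : S ⊆ Nat.primesLE ⌊z⌋₊ := fun p hp =>
    Nat.mem_primesLE.mpr ⟨(hmemS p hp).2.2, (hmemS p hp).1⟩
  have hpt : ∀ p ∈ S, (1 - g p)⁻¹ ≤
      Real.exp (A * (1 / (p : ℝ)) + A ^ 2 / δ * (1 / ((p : ℝ) * ((p : ℝ) - 1)))) := by
    intro p hp
    obtain ⟨hg0, hgA, hgδ⟩ := hg p (hmemS p hp).1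
    have hp2 : (2 : ℝ) ≤ p := by exact_mod_cast (hmemS p hp).1.two_le
    have hp0 : (0 : ℝ) < p := by linarith
    refine (inv_one_sub_le_exp hδ hgδ).trans (Real.exp_le_exp.mpr ?_)
    have h1 : g p ≤ A * (1 / (p : ℝ)) := by rw [mul_one_div]; exact hgA
    have h2 : g p ^ 2 / δ ≤ A ^ 2 / δ * (1 / ((p : ℝ) * ((p : ℝ) - 1))) := by
      have hA0 : (0 : ℝ) ≤ A := Nat.cast_nonneg A
      have hsq : g p ^ 2 ≤ (A / p) ^ 2 := pow_le_pow_left₀ hg0 hgA 2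
      have hpp : (A / (p : ℝ)) ^ 2 ≤ A ^ 2 * (1 / ((p : ℝ) * ((p : ℝ) - 1))) := by
        rw [div_pow, mul_one_div]
        exact div_le_div_of_nonneg_left (by positivity) (mul_pos hp0 (by linarith)) (by nlinarith)
      calc g p ^ 2 / δ ≤ (A / p) ^ 2 / δ := div_le_div_of_nonneg_right hsq hδ.le
        _ ≤ A ^ 2 * (1 / ((p : ℝ) * ((p : ℝ) - 1))) / δ := div_le_div_of_nonneg_right hpp hδ.le
        _ = A ^ 2 / δ * (1 / ((p : ℝ) * ((p : ℝ) - 1))) := by ring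
    linarith
  have hnonneg : ∀ p ∈ S, 0 ≤ (1 - g p)⁻¹ := fun p hp =>
    inv_nonneg.mpr (by linarith [(hg p (hmemS p hp).1).2.2])
  have hsum1 : ∑ p ∈ S, (1 : ℝ) / p ≤
      Real.log (Real.log z) - Real.log (Real.log w) + (9 / 2 + 6 / Real.log 2) :=
    sum_primesWindow_one_div_le hw hwz
  have hsum2 : ∑ p ∈ S, (1 : ℝ) / (p * (p - 1)) ≤ 1 :=
    (Finset.sum_le_sum_of_subset_of_nonneg hSle fun p hp _ => by
      have hp2 : (2 : ℝ) ≤ p := by exact_mod_cast (Nat.mem_primesLE.mp hp).2.two_le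
      have : (0 : ℝ) < p * (p - 1) := mul_pos (by linarith) (by linarith)
      positivity).trans
      (LFunctions.MertensBound.sum_inv_prime_mul_pred_le_one ⌊z⌋₊)
  have hE : Real.exp (Real.log (Real.log z) - Real.log (Real.log w)) = Real.log z / Real.log w := by
    rw [Real.exp_sub, Real.exp_log hlogz, Real.exp_log hlogw]
  have hA0 : (0 : ℝ) ≤ A := Nat.cast_nonneg A
  have hA2δ : (0 : ℝ) ≤ A ^ 2 / δ := by positivity
  calc ∏ p ∈ S, (1 - g p)⁻¹
      ≤ ∏ p ∈ S, Real.exp (A * (1 / (p : ℝ)) + A ^ 2 / δ * (1 / ((p : ℝ) * ((p : ℝ) - 1)))) :=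
        Finset.prod_le_prod hnonneg hpt
    _ = Real.exp (A * ∑ p ∈ S, 1 / (p : ℝ) + A ^ 2 / δ * ∑ p ∈ S, 1 / ((p : ℝ) * ((p : ℝ) - 1))) := by
        rw [← Real.exp_sum, Finset.sum_add_distrib, Finset.mul_sum, Finset.mul_sum]
    _ ≤ Real.exp (A * (Real.log (Real.log z) - Real.log (Real.log w) + (9 / 2 + 6 / Real.log 2)) +
          A ^ 2 / δ * 1) := by
        refine Real.exp_le_exp.mpr (add_le_add ?_ ?_)
        · exact mul_le_mul_of_nonneg_left hsum1 hA0
        · exact mul_le_mul_of_nonneg_left hsum2 hA2δ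
    _ = Real.exp (A * (9 / 2 + 6 / Real.log 2) + A ^ 2 / δ) *
          Real.exp (A * (Real.log (Real.log z) - Real.log (Real.log w))) := by
        rw [← Real.exp_add]; congr 1; ring
    _ = Real.exp (A * (9 / 2 + 6 / Real.log 2) + A ^ 2 / δ) * (Real.log z / Real.log w) ^ (A : ℝ) := by
        rw [← hE, ← Real.exp_mul, mul_comm (Real.log (Real.log z) - _)]

/-- The explicit dimension constant `K₃ = exp(3(9/2 + 6/log 2) + 18)` for the densities of `𝒜` and
`ℬ` (both `≤ 3/p` and `≤ 1/2`). [folklore] -/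
def dimConst : ℝ := Real.exp (3 * (9 / 2 + 6 / Real.log 2) + 3 ^ 2 / (1 / 2))

/-- **The density `ρ₀(d)/d` of `𝒜` satisfies `Ω(3)`** with constant `dimConst`: at a prime,
`ρ₀(p)/p = ν_p/(p+1) ≤ 3/p` and `≤ 1/2` (`ν_2 = ν_3 = 1`, `ν_p ≤ 3`). (Its true dimension is `1`, by
the prime ideal theorem for the degree-one primes; the crude value `3` only affects constants.)
[cite: HeathBrownActa2001, §6 p. 34] -/
theorem hasSieveDimension_densA : HasSieveDimension densA 3 dimConst := by
  have h := hasSieveDimension_of_le_div (g := densA) (A := 3) (δ := 1 / 2) (by norm_num)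
    (fun p hp => ?_)
  · simpa [dimConst] using h
  rw [densA_prime hp]
  have hp2 : (2 : ℝ) ≤ p := by exact_mod_cast hp.two_le
  have hν : (cubeRootTwoCount p : ℝ) ≤ 3 := by exact_mod_cast cubeRootTwoCount_le_three hp
  refine ⟨by positivity, ?_, ?_⟩
  · rw [div_le_div_iff₀ (by linarith) (by linarith)]
    push_cast
    nlinarith
  · -- `ν_p/(p+1) ≤ 1/2`: for `p ≥ 5` from `ν_p ≤ 3`, for `p = 2, 3` from `ν_2 = ν_3 = 1`
    by_cases hp5 : 5 ≤ p
    · have hp5' : (5 : ℝ) ≤ p := by exact_mod_cast hp5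
      rw [div_le_iff₀ (by linarith)]
      linarith
    · have hp23 : p = 2 ∨ p = 3 := by
        have := hp.two_le
        interval_cases p
        · exact Or.inl rfl
        · exact Or.inr rfl
        · exact absurd hp (by decide)
      rcases hp23 with rfl | rfl
      · rw [cubeRootTwoCount_two]; norm_num
      · rw [cubeRootTwoCount_three]; norm_num

end Literature.NumberTheory.Sieve.CubicSieve

end
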